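import Mathlib

/-!
# Stub `stub_windowRatio` for line `Sketch` of crux `FemtoCurvatureTwoPointC`

Pure real arithmetic. A positive box function `v` (the finite-volume coupling at a frozen bare
coupling) has *in-window comparability*: `|1/v(M) − 1/v(M')| ≤ κ₂` for `8 ≤ M ≤ M' ≤ 2M` whenever
every sub-box `8 ≤ M'' ≤ M` has `v ≤ u₀`. Inside a box `L` all of whose sub-boxes `8 ≤ M ≤ L`
carry `v(M) ≤ w`, with `w ≤ u₀` and `w · (|κ₂| + 1) ≤ 1/4`, we show `v(M₁)² ≤ 4 · v(M₂)²` for any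
two boxes `M₁, M₂ ∈ [8, L]` within a factor `4` of each other.

* ONE OCTAVE (`8 ≤ M ≤ M' ≤ 2M`, `M' ≤ L`): the window hypothesis at `M` holds (`v ≤ w ≤ u₀` on
  `[8, L] ⊇ [8, M]`), so with `a = v M`, `b = v M'` one has `|b − a| ≤ κ₂ · a · b ≤ |κ₂| · a · b`,
  and `|κ₂| · b ≤ |κ₂| · w ≤ w · (|κ₂| + 1) ≤ 1/4` (likewise for `a`), whence `4 b ≤ 5 a` and
  `4 a ≤ 5 b`;
* TWO OCTAVES (`8 ≤ A ≤ B ≤ 4A`, `B ≤ L`): either `B ≤ 2A` (one step) or `A → 2A → B`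
  (`2A < B ≤ L`), giving `16 · v B ≤ 25 · v A` and `16 · v A ≤ 25 · v B`;
* squaring `16 · v M₁ ≤ 25 · v M₂` gives `v M₁ ² ≤ (625/256) · v M₂ ² ≤ 4 · v M₂ ²`.
-/

set_option autoImplicit false

namespace Summit.QuantumFields.YangMills.Theorems.FemtoCurvatureTwoPointC

/-- **One octave.** Under the hypotheses of `stub_windowRatio`, for `8 ≤ M ≤ M' ≤ 2M` with
`M' ≤ L` the values `v M` and `v M'` are within a factor `5/4` of each other:
`4 · v M' ≤ 5 · v M` and `4 · v M ≤ 5 · v M'`. [folklore] -/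
theorem windowRatio_oneOctave (v : ℕ → ℝ) (u₀ w κ₂ : ℝ) (L : ℕ)
    (hpos : ∀ M : ℕ, 8 ≤ M → 0 < v M)
    (hcomp : ∀ M M' : ℕ, 8 ≤ M → M ≤ M' → M' ≤ 2 * M →
      (∀ M'' : ℕ, 8 ≤ M'' → M'' ≤ M → v M'' ≤ u₀) → |(v M)⁻¹ - (v M')⁻¹| ≤ κ₂)
    (hwu : w ≤ u₀) (hw : w * (|κ₂| + 1) ≤ 1 / 4)
    (hL : ∀ M : ℕ, 8 ≤ M → M ≤ L → v M ≤ w)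
    (M M' : ℕ) (hM : 8 ≤ M) (hMM' : M ≤ M') (hM'M : M' ≤ 2 * M) (hM'L : M' ≤ L) :
    4 * v M' ≤ 5 * v M ∧ 4 * v M ≤ 5 * v M' := by
  have hML : M ≤ L := le_trans hMM' hM'L
  have hM' : 8 ≤ M' := le_trans hM hMM'
  have hwin : ∀ M'' : ℕ, 8 ≤ M'' → M'' ≤ M → v M'' ≤ u₀ :=
    fun M'' h₁ h₂ => le_trans (hL M'' h₁ (le_trans h₂ hML)) hwu
  have hk : |(v M)⁻¹ - (v M')⁻¹| ≤ κ₂ := hcomp M M' hM hMM' hM'M hwin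
  have ha : 0 < v M := hpos M hM
  have hb : 0 < v M' := hpos M' hM'
  have haw : v M ≤ w := hL M hM hML
  have hbw : v M' ≤ w := hL M' hM' hM'L
  have hwpos : 0 < w := lt_of_lt_of_le ha haw
  have hab : 0 < v M * v M' := mul_pos ha hb
  -- the inverse difference as a quotient, cleared of its (positive) denominator
  have hk' : |v M' - v M| ≤ κ₂ * (v M * v M') := by
    rw [inv_sub_inv (ne_of_gt ha) (ne_of_gt hb), abs_div, abs_of_pos hab,
      div_le_iff₀ hab] at hk
    exact hk
  have hk'' : |v M' - v M| ≤ |κ₂| * (v M * v M') :=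
    le_trans hk' (mul_le_mul_of_nonneg_right (le_abs_self κ₂) (le_of_lt hab))
  have hκw : |κ₂| * w ≤ 1 / 4 := by nlinarith [abs_nonneg κ₂]
  have hκb : |κ₂| * v M' ≤ 1 / 4 :=
    le_trans (mul_le_mul_of_nonneg_left hbw (abs_nonneg κ₂)) hκw
  have hκa : |κ₂| * v M ≤ 1 / 4 :=
    le_trans (mul_le_mul_of_nonneg_left haw (abs_nonneg κ₂)) hκw
  obtain ⟨h₁, h₂⟩ := abs_sub_le_iff.mp hk''
  have e₁ : |κ₂| * (v M * v M') = v M * (|κ₂| * v M') := by ring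
  have e₂ : |κ₂| * (v M * v M') = v M' * (|κ₂| * v M) := by ring
  have f₁ : v M * (|κ₂| * v M') ≤ v M * (1 / 4) := mul_le_mul_of_nonneg_left hκb (le_of_lt ha)
  have f₂ : v M' * (|κ₂| * v M) ≤ v M' * (1 / 4) := mul_le_mul_of_nonneg_left hκa (le_of_lt hb)
  constructor
  · linarith
  · linarith

/-- **Two octaves.** Under the hypotheses of `stub_windowRatio`, for `8 ≤ A ≤ B ≤ 4A` with
`B ≤ L` the values `v A` and `v B` are within a factor `25/16` of each other:
`16 · v B ≤ 25 · v A` and `16 · v A ≤ 25 · v B` (one octave if `B ≤ 2A`, else `A → 2A → B`).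
[folklore] -/
theorem windowRatio_twoOctaves (v : ℕ → ℝ) (u₀ w κ₂ : ℝ) (L : ℕ)
    (hpos : ∀ M : ℕ, 8 ≤ M → 0 < v M)
    (hcomp : ∀ M M' : ℕ, 8 ≤ M → M ≤ M' → M' ≤ 2 * M →
      (∀ M'' : ℕ, 8 ≤ M'' → M'' ≤ M → v M'' ≤ u₀) → |(v M)⁻¹ - (v M')⁻¹| ≤ κ₂)
    (hwu : w ≤ u₀) (hw : w * (|κ₂| + 1) ≤ 1 / 4)
    (hL : ∀ M : ℕ, 8 ≤ M → M ≤ L → v M ≤ w)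
    (A B : ℕ) (hA : 8 ≤ A) (hAB : A ≤ B) (hB4 : B ≤ 4 * A) (hBL : B ≤ L) :
    16 * v B ≤ 25 * v A ∧ 16 * v A ≤ 25 * v B := by
  have hApos : 0 < v A := hpos A hA
  have hBpos : 0 < v B := hpos B (le_trans hA hAB)
  by_cases h2 : B ≤ 2 * A
  · obtain ⟨h₁, h₂⟩ :=
      windowRatio_oneOctave v u₀ w κ₂ L hpos hcomp hwu hw hL A B hA hAB h2 hBL
    constructor
    · linarith
    · linarith
  · rw [not_le] at h2
    have h2AL : 2 * A ≤ L := le_trans (le_of_lt h2) hBL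
    obtain ⟨s₁, s₂⟩ :=
      windowRatio_oneOctave v u₀ w κ₂ L hpos hcomp hwu hw hL A (2 * A) hA (by omega) le_rfl h2AL
    obtain ⟨t₁, t₂⟩ :=
      windowRatio_oneOctave v u₀ w κ₂ L hpos hcomp hwu hw hL (2 * A) B (by omega) (le_of_lt h2)
        (by omega) hBL
    constructor
    · linarith
    · linarith

/-- **Window ratio.** If a positive box function `v` (the coupling at a frozen `β`) has in-window
comparability `|1/v(M) − 1/v(M')| ≤ κ₂` for `8 ≤ M ≤ M' ≤ 2M` (box `M` in the `u₀`-window) and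
every box `8 ≤ M ≤ L` satisfies `v(M) ≤ w ≤ u₀` with `w · (|κ₂| + 1) ≤ 1/4`, then `v²` changes by
at most a factor `4` between any two boxes `M₁, M₂ ∈ [8, L]` within a factor `4` of each other.
[folklore] -/
theorem stub_windowRatio :
    ∀ (v : ℕ → ℝ) (u₀ w κ₂ : ℝ) (L : ℕ),
      (∀ M : ℕ, 8 ≤ M → 0 < v M) →
      (∀ M M' : ℕ, 8 ≤ M → M ≤ M' → M' ≤ 2 * M → (∀ M'' : ℕ, 8 ≤ M'' → M'' ≤ M → v M'' ≤ u₀) →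
          |(v M)⁻¹ - (v M')⁻¹| ≤ κ₂) →
      w ≤ u₀ → w * (|κ₂| + 1) ≤ 1 / 4 →
      (∀ M : ℕ, 8 ≤ M → M ≤ L → v M ≤ w) →
      ∀ M₁ M₂ : ℕ, 8 ≤ M₁ → 8 ≤ M₂ → M₁ ≤ L → M₂ ≤ L → M₁ ≤ 4 * M₂ → M₂ ≤ 4 * M₁ →
        v M₁ ^ 2 ≤ 4 * v M₂ ^ 2 := by
  intro v u₀ w κ₂ L hpos hcomp hwu hw hL M₁ M₂ hM₁ hM₂ hM₁L hM₂L h₁₂ h₂₁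
  have hv₁ : 0 < v M₁ := hpos M₁ hM₁
  have hv₂ : 0 < v M₂ := hpos M₂ hM₂
  have key : 16 * v M₁ ≤ 25 * v M₂ := by
    rcases le_total M₁ M₂ with h | h
    · exact (windowRatio_twoOctaves v u₀ w κ₂ L hpos hcomp hwu hw hL M₁ M₂ hM₁ h h₂₁ hM₂L).2
    · exact (windowRatio_twoOctaves v u₀ w κ₂ L hpos hcomp hwu hw hL M₂ M₁ hM₂ h h₁₂ hM₁L).1
  have hsq : (16 * v M₁) ^ 2 ≤ (25 * v M₂) ^ 2 :=
    pow_le_pow_left₀ (by linarith) key 2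
  nlinarith [sq_nonneg (v M₂), hsq]

end Summit.QuantumFields.YangMills.Theorems.FemtoCurvatureTwoPointC
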